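import Summits.QuantumFields.YangMills.Theses.ParabolicTrajectory

/-!
# Stub 1 `UVPassage` of the skeleton `dissipative-bridge` (crux `LatticeGapOnTrajectory`, stmt-QuantumFields-10523)
is a theorem of the hypothesis structure `BalabanBanachStep`

Refuter (cdisprove gen 3) file on the Negative lane (companion of `Negative.JunkCharts`; self-contained: the skeleton's
`InChart`, `tubeTop`, `Tube`, `TubeAdmissible`, `le_tubeTop` are copied verbatim into the namespace `…Negative.Stubs`). It settles the
adversary's question "can stub 1 be refuted?" in the negative by PROVING it: `uvPassage_holds` (statement inline, equal
to the body of `DissipativeBridge.UVPassage` in `Cruxes/LatticeGapOnTrajectory/Lines/dissipative-bridge.lean`, sha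
4ba1ce0c…, so `stub_uvPassage : UVPassage := uvPassage_holds` closes the stub definitionally). With
`Negative.JunkCharts` (`uvPassage_false_without_drift/_absorption`) the admissibility block is exactly what the proof
uses. No route statement is asserted. The one-step lemmas `step_*` are shared with the proof of stub 3
(`Negative.StubAnchoring`).
-/

namespace Summit.QuantumFields.YangMills.Theorems.LatticeGapOnTrajectory.Negative.Stubs

open Filter Topology
open Literature.MathematicalPhysics.QuantumFieldTheory

noncomputable section

section Copies

variable {G : Type} [Group G] [TopologicalSpace G] [IsTopologicalGroup G] [CompactSpace G]
  [MeasurableSpace G] [BorelSpace G] {r : LatticeRep G} {M : ℕ} (S : BalabanBanachStep G r M)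

/-- COPY of `DissipativeBridge.InChart`. [folklore] -/
def InChart (p : ℝ × S.E) (j : ℕ) : Prop :=
  ∀ l ≤ j, (S.F^[l] p).1 ∈ Set.Icc 0 S.δ ∧ ‖(S.F^[l] p).2‖ ≤ S.R

/-- COPY of `DissipativeBridge.tubeTop`. [folklore] -/
def tubeTop (γ : ℝ) : ℝ := γ + (S.b + S.C * (S.δ + S.R)) * γ ^ 3

/-- COPY of `DissipativeBridge.Tube`. [folklore] -/
def Tube (γ ρ : ℝ) : Set (ℝ × S.E) :=
  {p | γ ≤ p.1 ∧ p.1 ≤ tubeTop S γ ∧ ‖p.2‖ ≤ ρ}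

/-- COPY of `DissipativeBridge.TubeAdmissible`. [folklore] -/
def TubeAdmissible (γ ρ : ℝ) : Prop :=
  0 < γ ∧ 0 < ρ ∧ ρ ≤ S.R ∧ tubeTop S γ ≤ S.δ ∧
  2 * S.C * (tubeTop S γ) ^ 2 ≤ (1 - S.θ') * ρ ∧
  S.C * (tubeTop S γ + ρ) ≤ S.b / 2 ∧
  S.C * (tubeTop S γ + S.R) * (tubeTop S γ) ^ 2 ≤ 1 / 2

/-- COPY of `DissipativeBridge.le_tubeTop`. [folklore] -/
theorem le_tubeTop {γ : ℝ} (hγ : 0 ≤ γ) : γ ≤ tubeTop S γ := by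
  unfold tubeTop
  have h1 : 0 ≤ S.b + S.C * (S.δ + S.R) := by
    have := S.b_pos; have := S.C_pos; have := S.δ_pos; have := S.R_pos
    positivity
  nlinarith [pow_nonneg hγ 3]

end Copies

/-! ### One-step bounds below the tube top -/

section Steps

variable {G : Type} [Group G] [TopologicalSpace G] [IsTopologicalGroup G] [CompactSpace G]
  [MeasurableSpace G] [BorelSpace G] {r : LatticeRep G} {M : ℕ} (S : BalabanBanachStep G r M)
  {γ ρ : ℝ}

/-- The coupling at most halves in one step (positivity is kept): uses `C(γ⁺ + R)γ⁺² ≤ 1/2`. [folklore] -/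
theorem step_lower (hadm : TubeAdmissible S γ ρ) {g : ℝ} {y : S.E} (hg0 : 0 ≤ g) (hgp : g ≤ tubeTop S γ)
    (hy : ‖y‖ ≤ S.R) : g / 2 ≤ S.φ g y := by
  obtain ⟨-, -, -, htop, -, -, hhalf⟩ := hadm
  have hgδ : |g| ≤ S.δ := by rw [abs_of_nonneg hg0]; exact hgp.trans htop
  have hrem := S.remainder_basin g y hgδ hy
  rw [abs_of_nonneg hg0] at hrem
  have h1 := (abs_le.1 hrem).1
  have hC := S.C_pos.le
  have hb := S.b_pos.le
  have hR := S.R_pos.le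
  have hg3 : 0 ≤ g ^ 3 := by positivity
  have htp : 0 ≤ tubeTop S γ := hg0.trans hgp
  have key : S.C * (g ^ 4 + g ^ 3 * ‖y‖) ≤ g / 2 := by
    have hsq : g ^ 2 ≤ (tubeTop S γ) ^ 2 := pow_le_pow_left₀ hg0 hgp 2
    have hsum : g + S.R ≤ tubeTop S γ + S.R := by linarith
    calc S.C * (g ^ 4 + g ^ 3 * ‖y‖) ≤ S.C * (g ^ 4 + g ^ 3 * S.R) := by gcongr
      _ = g * (S.C * (g ^ 2 * (g + S.R))) := by ring
      _ ≤ g * (S.C * ((tubeTop S γ) ^ 2 * (tubeTop S γ + S.R))) := by gcongr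
      _ = g * (S.C * (tubeTop S γ + S.R) * (tubeTop S γ) ^ 2) := by ring
      _ ≤ g * (1 / 2) := by gcongr
      _ = g / 2 := by ring
  nlinarith [mul_nonneg hb hg3]

/-- One step moves the coupling up by at most `(b + C(δ + R)) g³`. [folklore] -/
theorem step_upper (hadm : TubeAdmissible S γ ρ) {g : ℝ} {y : S.E} (hg0 : 0 ≤ g) (hgp : g ≤ tubeTop S γ)
    (hy : ‖y‖ ≤ S.R) : S.φ g y ≤ g + (S.b + S.C * (S.δ + S.R)) * g ^ 3 := by
  obtain ⟨-, -, -, htop, -, -, -⟩ := hadm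
  have hgδ' : g ≤ S.δ := hgp.trans htop
  have hgδ : |g| ≤ S.δ := by rw [abs_of_nonneg hg0]; exact hgδ'
  have hrem := S.remainder_basin g y hgδ hy
  rw [abs_of_nonneg hg0] at hrem
  have h2 := (abs_le.1 hrem).2
  have hC := S.C_pos.le
  have hg3 : 0 ≤ g ^ 3 := by positivity
  have key : S.C * (g ^ 4 + g ^ 3 * ‖y‖) ≤ S.C * (S.δ + S.R) * g ^ 3 := by
    calc S.C * (g ^ 4 + g ^ 3 * ‖y‖) ≤ S.C * (g ^ 4 + g ^ 3 * S.R) := by gcongr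
      _ = S.C * (g + S.R) * g ^ 3 := by ring
      _ ≤ S.C * (S.δ + S.R) * g ^ 3 := by gcongr
  nlinarith

/-- Fibre step below the tube top: `‖Ψ g y‖ ≤ θ'‖y‖ + C γ⁺²`. [folklore] -/
theorem step_fibre (hadm : TubeAdmissible S γ ρ) {g : ℝ} {y : S.E} (hg0 : 0 ≤ g) (hgp : g ≤ tubeTop S γ)
    (hy : ‖y‖ ≤ S.R) : ‖S.Ψ g y‖ ≤ S.θ' * ‖y‖ + S.C * (tubeTop S γ) ^ 2 := by
  obtain ⟨-, -, -, htop, -, -, -⟩ := hadm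
  have hgδ : |g| ≤ S.δ := by rw [abs_of_nonneg hg0]; exact hgp.trans htop
  have h := S.norm_Ψ_le hgδ hy
  have hC := S.C_pos.le
  have hsq : g ^ 2 ≤ (tubeTop S γ) ^ 2 := pow_le_pow_left₀ hg0 hgp 2
  nlinarith [mul_le_mul_of_nonneg_left hsq hC]

/-- `C γ⁺² ≤ (1 − θ') ρ / 2` (half of the absorption conjunct). [folklore] -/
theorem C_sq_le (hadm : TubeAdmissible S γ ρ) : S.C * (tubeTop S γ) ^ 2 ≤ (1 - S.θ') * ρ / 2 := by
  obtain ⟨-, -, -, -, habs, -, -⟩ := hadm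
  linarith

/-- The basin `‖y‖ ≤ R` is kept below the tube top. [folklore] -/
theorem step_fibre_R (hadm : TubeAdmissible S γ ρ) {g : ℝ} {y : S.E} (hg0 : 0 ≤ g) (hgp : g ≤ tubeTop S γ)
    (hy : ‖y‖ ≤ S.R) : ‖S.Ψ g y‖ ≤ S.R := by
  have h := step_fibre S hadm hg0 hgp hy
  have h2 := C_sq_le S hadm
  obtain ⟨-, hρ, hρR, -, -, -, -⟩ := hadm
  have hθ0 := S.θ'_nonneg
  have hθ1 := S.θ'_lt_one
  nlinarith [mul_le_mul_of_nonneg_left hy hθ0]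

/-- Post-absorption drift: with `‖y‖ ≤ ρ`, `φ g y ≥ g + (b/2) g³` (uses `C(γ⁺ + ρ) ≤ b/2`). [folklore] -/
theorem step_drift (hadm : TubeAdmissible S γ ρ) {g : ℝ} {y : S.E} (hg0 : 0 ≤ g) (hgp : g ≤ tubeTop S γ)
    (hy : ‖y‖ ≤ ρ) : g + S.b / 2 * g ^ 3 ≤ S.φ g y := by
  obtain ⟨-, -, hρR, htop, -, hdrift, -⟩ := hadm
  have hyR : ‖y‖ ≤ S.R := hy.trans hρR
  have hgδ : |g| ≤ S.δ := by rw [abs_of_nonneg hg0]; exact hgp.trans htop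
  have hrem := S.remainder_basin g y hgδ hyR
  rw [abs_of_nonneg hg0] at hrem
  have h1 := (abs_le.1 hrem).1
  have hC := S.C_pos.le
  have hg3 : 0 ≤ g ^ 3 := by positivity
  have key : S.C * (g ^ 4 + g ^ 3 * ‖y‖) ≤ S.b / 2 * g ^ 3 := by
    calc S.C * (g ^ 4 + g ^ 3 * ‖y‖) ≤ S.C * (g ^ 4 + g ^ 3 * ρ) := by gcongr
      _ = S.C * (g + ρ) * g ^ 3 := by ring
      _ ≤ S.C * (tubeTop S γ + ρ) * g ^ 3 := by gcongr
      _ ≤ S.b / 2 * g ^ 3 := by gcongr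
  nlinarith

end Steps

/-! ### The stub -/

/-- **Stub 1 `UVPassage` of the skeleton `dissipative-bridge` holds** (statement inline = the skeleton's body, with
the copies `InChart`, `Tube`, `TubeAdmissible`): Wilson orbits enter every admissible tube at their first passage above
`γ`, with in-chart history. Use: `theorem stub_uvPassage : UVPassage := uvPassage_holds` (definitional). [folklore] -/
theorem uvPassage_holds :
    ∀ (G : Type) [Group G] [TopologicalSpace G] [IsTopologicalGroup G] [CompactSpace G]
      [MeasurableSpace G] [BorelSpace G] (r : LatticeRep G) (M : ℕ) (S : BalabanBanachStep G r M)
      (γ ρ : ℝ), TubeAdmissible S γ ρ →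
      ∃ g₁ : ℝ, 0 < g₁ ∧ g₁ ≤ S.g₀ ∧ ∀ g ∈ Set.Ioc 0 g₁, ∃ j : ℕ,
        S.F^[j] (g, S.yW g) ∈ Tube S γ ρ ∧ InChart S (g, S.yW g) j ∧
        ∀ l < j, (S.F^[l] (g, S.yW g)).1 < γ := by
  intro G _ _ _ _ _ _ r M S γ ρ hadm
  have hadm' := hadm
  obtain ⟨hγ, hρ, hρR, htop, habs, hdrift, hhalf⟩ := hadm'
  -- constants
  have hθ0 := S.θ'_nonneg
  have hθ1 := S.θ'_lt_one
  have hRpos := S.R_pos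
  have hC := S.C_pos.le
  have hb := S.b_pos
  have hγp : γ ≤ tubeTop S γ := le_tubeTop S hγ.le
  set c : ℝ := S.b + S.C * (S.δ + S.R) with hc
  have hcpos : 0 < c := by have := S.δ_pos; positivity
  set Kg : ℝ := 1 + c * (tubeTop S γ) ^ 2 with hKg
  have hKg1 : 1 ≤ Kg := by
    have : 0 ≤ c * (tubeTop S γ) ^ 2 := by positivity
    linarith
  have hKg0 : 0 < Kg := by linarith
  -- absorption time j₀ : θ'^{j₀} R ≤ ρ / 2
  obtain ⟨j₀, hj₀⟩ : ∃ j₀ : ℕ, S.θ' ^ j₀ * S.R ≤ ρ / 2 := by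
    obtain ⟨n, hn⟩ := exists_pow_lt_of_lt_one (show 0 < ρ / (2 * S.R) by positivity) hθ1
    refine ⟨n, ?_⟩
    have := (lt_div_iff₀ (by positivity : (0 : ℝ) < 2 * S.R)).1 hn
    linarith
  -- entrance coupling
  set g₁ : ℝ := min S.g₀ (γ / (2 * Kg ^ j₀)) with hg₁
  have hKpow : 0 < Kg ^ j₀ := by positivity
  have hg₁pos : 0 < g₁ := lt_min S.g₀_pos (by positivity)
  refine ⟨g₁, hg₁pos, min_le_left _ _, fun g hg => ?_⟩
  have hgpos : 0 < g := hg.1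
  have hgg₀ : g ≤ S.g₀ := hg.2.trans (min_le_left _ _)
  have hgsmall : g * Kg ^ j₀ ≤ γ / 2 := by
    have : g ≤ γ / (2 * Kg ^ j₀) := hg.2.trans (min_le_right _ _)
    rw [le_div_iff₀ (by positivity)] at this
    linarith
  have hgγ : g < γ := by
    have : g ≤ g * Kg ^ j₀ := le_mul_of_one_le_right hgpos.le (one_le_pow₀ hKg1)
    linarith
  -- the orbit
  set p : ℕ → ℝ × S.E := fun l => S.F^[l] (g, S.yW g) with hp
  have p0 : p 0 = (g, S.yW g) := rfl
  have psucc : ∀ l, p (l + 1) = S.F (p l) := fun l => Function.iterate_succ_apply' _ _ _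
  have Ffst : ∀ q : ℝ × S.E, (S.F q).1 = S.φ q.1 q.2 := fun q => rfl
  have Fsnd : ∀ q : ℝ × S.E, (S.F q).2 = S.Ψ q.1 q.2 := fun q => rfl
  -- one step from a state below γ
  have hstep : ∀ q : ℝ × S.E, 0 < q.1 → q.1 < γ → ‖q.2‖ ≤ S.R →
      0 < (S.F q).1 ∧ (S.F q).1 ≤ tubeTop S γ ∧ ‖(S.F q).2‖ ≤ S.R ∧ (S.F q).1 ≤ q.1 * Kg ∧
        ‖(S.F q).2‖ ≤ S.θ' * ‖q.2‖ + S.C * (tubeTop S γ) ^ 2 := by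
    intro q hq0 hqγ hqy
    have hqp : q.1 ≤ tubeTop S γ := hqγ.le.trans hγp
    rw [Ffst, Fsnd]
    have hlow := step_lower S hadm hq0.le hqp hqy
    have hup := step_upper S hadm hq0.le hqp hqy
    refine ⟨by linarith, ?_, step_fibre_R S hadm hq0.le hqp hqy, ?_, step_fibre S hadm hq0.le hqp hqy⟩
    · -- φ ≤ q.1 + c q.1³ ≤ γ + c γ³ = tubeTop
      have h3 : q.1 ^ 3 ≤ γ ^ 3 := pow_le_pow_left₀ hq0.le hqγ.le 3
      have : q.1 + c * q.1 ^ 3 ≤ γ + c * γ ^ 3 := add_le_add hqγ.le (mul_le_mul_of_nonneg_left h3 hcpos.le)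
      simpa [tubeTop, hc] using hup.trans this
    · -- φ ≤ q.1 (1 + c q.1²) ≤ q.1 Kg
      have hsq : q.1 ^ 2 ≤ (tubeTop S γ) ^ 2 := pow_le_pow_left₀ hq0.le hqp 2
      have : q.1 + c * q.1 ^ 3 ≤ q.1 * Kg := by
        rw [hKg]
        have : c * q.1 ^ 3 = q.1 * (c * q.1 ^ 2) := by ring
        nlinarith [mul_le_mul_of_nonneg_left (mul_le_mul_of_nonneg_left hsq hcpos.le) hq0.le]
      exact hup.trans this
  -- the orbit invariant while below γ
  have hInv : ∀ i : ℕ, (∀ i' < i, (p i').1 < γ) →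
      0 < (p i).1 ∧ (p i).1 ≤ tubeTop S γ ∧ ‖(p i).2‖ ≤ S.R ∧ (p i).1 ≤ g * Kg ^ i ∧
        ‖(p i).2‖ ≤ S.θ' ^ i * S.R + ρ / 2 := by
    intro i
    induction i with
    | zero =>
      intro _
      have hy0 : ‖S.yW g‖ ≤ S.R := S.norm_yW_le g ⟨hgpos.le, hgg₀⟩
      refine ⟨hgpos, hgγ.le.trans hγp, hy0, by simp [p0], ?_⟩
      show ‖S.yW g‖ ≤ S.θ' ^ 0 * S.R + ρ / 2
      rw [pow_zero, one_mul]; linarith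
    | succ i ih =>
      intro H
      have hi := ih fun i' hi' => H i' (Nat.lt_succ_of_lt hi')
      have hγi : (p i).1 < γ := H i (Nat.lt_succ_self i)
      obtain ⟨h0, -, hR, hgrow, hfib⟩ := hi
      obtain ⟨s0, sp, sR, sgrow, sfib⟩ := hstep (p i) h0 hγi hR
      rw [psucc]
      refine ⟨s0, sp, sR, ?_, ?_⟩
      · calc (S.F (p i)).1 ≤ (p i).1 * Kg := sgrow
          _ ≤ g * Kg ^ i * Kg := mul_le_mul_of_nonneg_right hgrow hKg0.le
          _ = g * Kg ^ (i + 1) := by ring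
      · have h2 := C_sq_le S hadm
        calc ‖(S.F (p i)).2‖ ≤ S.θ' * ‖(p i).2‖ + S.C * (tubeTop S γ) ^ 2 := sfib
          _ ≤ S.θ' * (S.θ' ^ i * S.R + ρ / 2) + (1 - S.θ') * ρ / 2 :=
              add_le_add (mul_le_mul_of_nonneg_left hfib hθ0) h2
          _ = S.θ' ^ (i + 1) * S.R + ρ / 2 := by ring
  -- below γ up to the absorption time
  have hBelow : ∀ i, i ≤ j₀ → ∀ i' ≤ i, (p i').1 < γ := by
    intro i
    induction i with
    | zero =>
      intro _ i' hi'
      rw [Nat.le_zero.1 hi', p0]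
      exact hgγ
    | succ i ih =>
      intro hij i' hi'
      rcases Nat.lt_or_ge i' (i + 1) with hlt | hge
      · exact ih (Nat.le_of_succ_le hij) i' (Nat.lt_succ_iff.1 hlt)
      · have heq : i' = i + 1 := le_antisymm hi' hge
        subst heq
        have hprev := ih (Nat.le_of_succ_le hij)
        obtain ⟨-, -, -, hgrow, -⟩ := hInv (i + 1) fun i' hi' => hprev i' (Nat.lt_succ_iff.1 hi')
        have hpow : Kg ^ (i + 1) ≤ Kg ^ j₀ := pow_le_pow_right₀ hKg1 hij
        have : g * Kg ^ (i + 1) ≤ g * Kg ^ j₀ := mul_le_mul_of_nonneg_left hpow hgpos.le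
        linarith
  -- passage happens
  have hPass : ∃ l, γ ≤ (p l).1 := by
    by_contra hno
    push Not at hno
    have hall : ∀ i, 0 < (p i).1 ∧ (p i).1 ≤ tubeTop S γ ∧ ‖(p i).2‖ ≤ S.R ∧ (p i).1 ≤ g * Kg ^ i ∧
        ‖(p i).2‖ ≤ S.θ' ^ i * S.R + ρ / 2 := fun i => hInv i fun i' _ => hno i'
    -- absorbed from j₀ on
    have habsorb : ∀ i, j₀ ≤ i → ‖(p i).2‖ ≤ ρ := by
      intro i hi
      have h := (hall i).2.2.2.2
      have hpow : S.θ' ^ i ≤ S.θ' ^ j₀ := pow_le_pow_of_le_one hθ0 hθ1.le hi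
      have : S.θ' ^ i * S.R ≤ S.θ' ^ j₀ * S.R := mul_le_mul_of_nonneg_right hpow hRpos.le
      linarith
    -- linear growth from j₀ on
    set u : ℝ := (p j₀).1 with hu
    have hu0 : 0 < u := (hall j₀).1
    set d : ℝ := S.b / 2 * u ^ 3 with hd
    have hdpos : 0 < d := by positivity
    have hlin : ∀ n : ℕ, u + n * d ≤ (p (j₀ + n)).1 := by
      intro n
      induction n with
      | zero => simp [hu]
      | succ n ih =>
        have hn0 : 0 < (p (j₀ + n)).1 := (hall (j₀ + n)).1
        have hnp : (p (j₀ + n)).1 ≤ tubeTop S γ := (hall (j₀ + n)).2.1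
        have hny : ‖(p (j₀ + n)).2‖ ≤ ρ := habsorb (j₀ + n) (Nat.le_add_right _ _)
        have hdr := step_drift S hadm hn0.le hnp hny
        have hge_u : u ≤ (p (j₀ + n)).1 := by
          have : (0 : ℝ) ≤ n * d := by positivity
          linarith
        have hcube : u ^ 3 ≤ (p (j₀ + n)).1 ^ 3 := pow_le_pow_left₀ hu0.le hge_u 3
        rw [show j₀ + (n + 1) = (j₀ + n) + 1 by ring, psucc, Ffst]
        have : S.b / 2 * u ^ 3 ≤ S.b / 2 * (p (j₀ + n)).1 ^ 3 :=
          mul_le_mul_of_nonneg_left hcube (by positivity)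
        push_cast
        nlinarith
    obtain ⟨n, hn⟩ := exists_nat_ge (γ / d)
    have hnd : γ ≤ n * d := by
      rw [div_le_iff₀ hdpos] at hn
      exact hn
    have := hlin n
    have := hno (j₀ + n)
    linarith
  -- the first passage
  classical
  let j := Nat.find hPass
  have hj : γ ≤ (p j).1 := Nat.find_spec hPass
  have hmin : ∀ l < j, (p l).1 < γ := fun l hl => not_le.1 (Nat.find_min hPass hl)
  have hj₀ : j₀ < j := by
    by_contra hle
    push Not at hle
    have := hBelow j hle j le_rfl
    linarith
  have hInvj := hInv j hmin
  refine ⟨j, ⟨hj, hInvj.2.1, ?_⟩, ?_, hmin⟩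
  · -- absorbed at the entrance step
    have h := hInvj.2.2.2.2
    have hpow : S.θ' ^ j ≤ S.θ' ^ j₀ := pow_le_pow_of_le_one hθ0 hθ1.le hj₀.le
    have : S.θ' ^ j * S.R ≤ S.θ' ^ j₀ * S.R := mul_le_mul_of_nonneg_right hpow hRpos.le
    linarith
  · -- in-chart history
    intro l hl
    have hInvl := hInv l fun i' hi' => hmin i' (lt_of_lt_of_le hi' hl)
    exact ⟨⟨hInvl.1.le, hInvl.2.1.trans htop⟩, hInvl.2.2.1⟩

end

end Summit.QuantumFields.YangMills.Theorems.LatticeGapOnTrajectory.Negative.Stubs
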